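import Literature.AlgebraicGeometry.Resolution.DifferentialOperators
import Mathlib.RingTheory.MvPolynomial.Ideal
import Mathlib.RingTheory.MvPolynomial.Homogeneous
import HarnessLib

/-!
# Truncated polynomial algebras `B[X] ⧸ (X)^b`: coefficient functionals and the Hasse–Schmidt lemma

Topic: `Literature/AlgebraicGeometry/Resolution` (differential calculus used by the HIRONAKA-L lane library;
consumer: `Hironaka2017/Lib/InfinitesimalRetractionTaylor.lean`, thread Q-03-006). Pure commutative algebra.

For a commutative ring `B`, an index type `ι` and a level `b`:
* `TruncPoly.truncCoeff B ι b d : B[X] ⧸ (X)^b →ₗ[B] B` — the coefficient of `X^d` (zero for `|d| ≥ b`), with the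
  Leibniz rule `truncCoeff d (xy) = Σ_{e₁+e₂=d} truncCoeff e₁ x · truncCoeff e₂ y` for `|d| < b`;
* for a `K`-algebra map `ψ : B → B[X] ⧸ (X)^b` its HASSE–SCHMIDT COEFFICIENTS `TruncPoly.hsCoeff b ψ d : B →ₗ[K] B`;
* **the Hasse–Schmidt lemma** `TruncPoly.isDiffOpLE_hsCoeff`: if `ψ` has constant term the identity, `hsCoeff b ψ d`
  is a differential operator of `B/K` of order `≤ |d|` (`Resolution.IsDiffOpLE`, EGA IV₄ 16.8.8 (b)), by induction on
  `|d|` through `[D_d, a] = Σ_{e₁≠0} D_{e₁}(a)·D_{e₂}`; membership form `hsCoeff_mem_diffIdeal`.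

## Sources
* A. Grothendieck, J. Dieudonné, ÉGA IV₄ — Prop. 16.8.8 (b) (recursive commutator criterion for the order of a
  differential operator); §16.11 (Hasse–Schmidt type expansions). [EGAIV4]
* H. Matsumura, *Commutative Ring Theory*, §27 (higher derivations `D_n(ab) = Σ D_i(a) D_{n−i}(b)`). [Matsumura1987]
-/

namespace Literature.AlgebraicGeometry.Resolution

open _root_.MvPolynomial

namespace TruncPoly

section Trunc

variable {B : Type*} [CommRing B] {ι : Type*} {b : ℕ}

variable (B ι b) in
/-- The coefficient of `X^d` on `B[X] ⧸ (X)^b` (zero for `|d| ≥ b`), a `B`-linear functional. [cite: Matsumura1987, §27 (higher derivations of finite length = ring homomorphisms into B[t]/(t^{m+1}); D_n(xy) = Σ D_i(x) D_j(y))] -/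
noncomputable def truncCoeff (d : ι →₀ ℕ) : (MvPolynomial ι B ⧸ idealOfVars ι B ^ b) →ₗ[B] B :=
  ((idealOfVars ι B ^ b).restrictScalars B).liftQ (if d.degree < b then lcoeff B d else 0)
      (fun p hp => by
        rw [LinearMap.mem_ker]
        split_ifs with hd
        · rw [lcoeff_apply]
          exact (mem_pow_idealOfVars_iff' b p).1 hp d hd
        · rfl) ∘ₗ
    (Submodule.Quotient.restrictScalarsEquiv B (idealOfVars ι B ^ b)).symm.toLinearMap

/-- `truncCoeff d [p] = coeff d p` for `|d| < b`, `0` otherwise. [cite: Matsumura1987, §27 (higher derivations of finite length = ring homomorphisms into B[t]/(t^{m+1}); D_n(xy) = Σ D_i(x) D_j(y))] -/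
theorem truncCoeff_mk (d : ι →₀ ℕ) (p : MvPolynomial ι B) :
    truncCoeff B ι b d (Ideal.Quotient.mk _ p) = if d.degree < b then coeff d p else 0 := by
  show (if d.degree < b then lcoeff B d else 0 : MvPolynomial ι B →ₗ[B] B) p = _
  split_ifs <;> rfl

/-- `truncCoeff d [p] = coeff d p` for `|d| < b`. [cite: Matsumura1987, §27 (higher derivations of finite length = ring homomorphisms into B[t]/(t^{m+1}); D_n(xy) = Σ D_i(x) D_j(y))] -/
theorem truncCoeff_mk_of_lt {d : ι →₀ ℕ} (hd : d.degree < b) (p : MvPolynomial ι B) :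
    truncCoeff B ι b d (Ideal.Quotient.mk _ p) = coeff d p := by
  rw [truncCoeff_mk, if_pos hd]

/-- `|e₁| ≤ |d|` on the antidiagonal of `d`. [folklore] -/
private theorem degree_fst_le_of_mem_antidiagonal [DecidableEq ι] {d : ι →₀ ℕ} {e : (ι →₀ ℕ) × (ι →₀ ℕ)}
    (he : e ∈ Finset.antidiagonal d) : e.1.degree ≤ d.degree := by
  rw [Finset.mem_antidiagonal] at he
  rw [← he, map_add]
  exact Nat.le_add_right _ _

/-- `|e₂| ≤ |d|` on the antidiagonal of `d`. [folklore] -/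
private theorem degree_snd_le_of_mem_antidiagonal [DecidableEq ι] {d : ι →₀ ℕ} {e : (ι →₀ ℕ) × (ι →₀ ℕ)}
    (he : e ∈ Finset.antidiagonal d) : e.2.degree ≤ d.degree := by
  rw [Finset.mem_antidiagonal] at he
  rw [← he, map_add]
  exact Nat.le_add_left _ _

/-- **Leibniz rule for truncated coefficients**: `truncCoeff d (x y) = Σ_{e₁+e₂=d} truncCoeff e₁ x · truncCoeff e₂ y`
for `|d| < b`. [cite: Matsumura1987, §27 (higher derivations of finite length = ring homomorphisms into B[t]/(t^{m+1}); D_n(xy) = Σ D_i(x) D_j(y))] -/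
theorem truncCoeff_mul [DecidableEq ι] {d : ι →₀ ℕ} (hd : d.degree < b)
    (x y : MvPolynomial ι B ⧸ idealOfVars ι B ^ b) :
    truncCoeff B ι b d (x * y) =
      ∑ e ∈ Finset.antidiagonal d, truncCoeff B ι b e.1 x * truncCoeff B ι b e.2 y := by
  obtain ⟨p, rfl⟩ := Ideal.Quotient.mk_surjective x
  obtain ⟨q, rfl⟩ := Ideal.Quotient.mk_surjective y
  rw [← map_mul, truncCoeff_mk_of_lt hd, coeff_mul]
  refine Finset.sum_congr rfl fun e he => ?_
  rw [truncCoeff_mk_of_lt ((degree_fst_le_of_mem_antidiagonal he).trans_lt hd),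
    truncCoeff_mk_of_lt ((degree_snd_le_of_mem_antidiagonal he).trans_lt hd)]

variable {K : Type*} [CommRing K] [Algebra K B]

variable (b) in
/-- The Hasse–Schmidt coefficients of a `K`-algebra map `ψ : B → B[X] ⧸ (X)^b`: `d ↦ (g ↦ truncCoeff d (ψ g))`,
`K`-linear endomorphisms of `B`. [cite: Matsumura1987, §27 (higher derivations of finite length = ring homomorphisms into B[t]/(t^{m+1}); D_n(xy) = Σ D_i(x) D_j(y))] -/
noncomputable def hsCoeff (ψ : B →ₐ[K] MvPolynomial ι B ⧸ idealOfVars ι B ^ b) (d : ι →₀ ℕ) : B →ₗ[K] B :=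
  (truncCoeff B ι b d).restrictScalars K ∘ₗ ψ.toLinearMap

/-- `hsCoeff ψ d g = truncCoeff d (ψ g)`. [cite: Matsumura1987, §27 (higher derivations of finite length = ring homomorphisms into B[t]/(t^{m+1}); D_n(xy) = Σ D_i(x) D_j(y))] -/
@[simp] theorem hsCoeff_apply (ψ : B →ₐ[K] MvPolynomial ι B ⧸ idealOfVars ι B ^ b) (d : ι →₀ ℕ) (g : B) :
    hsCoeff b ψ d g = truncCoeff B ι b d (ψ g) := rfl

/-- Leibniz rule for the Hasse–Schmidt coefficients: `D_d(gh) = Σ_{e₁+e₂=d} D_{e₁} g · D_{e₂} h`, `|d| < b`.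
[cite: Matsumura1987, §27 (higher derivations of finite length = ring homomorphisms into B[t]/(t^{m+1}); D_n(xy) = Σ D_i(x) D_j(y))] -/
theorem hsCoeff_mul [DecidableEq ι] (ψ : B →ₐ[K] MvPolynomial ι B ⧸ idealOfVars ι B ^ b) {d : ι →₀ ℕ}
    (hd : d.degree < b) (g h : B) :
    hsCoeff b ψ d (g * h) = ∑ e ∈ Finset.antidiagonal d, hsCoeff b ψ e.1 g * hsCoeff b ψ e.2 h := by
  simp only [hsCoeff_apply, map_mul]
  exact truncCoeff_mul hd _ _

/-- The commutator of a Hasse–Schmidt coefficient with a multiplication, when `D_0 = id`: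
`[D_d, a] = Σ_{e₁+e₂=d, e₁≠0} D_{e₁}(a) · D_{e₂}`. [cite: Matsumura1987, §27 (higher derivations of finite length = ring homomorphisms into B[t]/(t^{m+1}); D_n(xy) = Σ D_i(x) D_j(y))] -/
theorem commMul_hsCoeff [DecidableEq ι] (ψ : B →ₐ[K] MvPolynomial ι B ⧸ idealOfVars ι B ^ b)
    (hψ : ∀ g, truncCoeff B ι b 0 (ψ g) = g) {d : ι →₀ ℕ} (hd : d.degree < b) (a : B) :
    commMul K (hsCoeff b ψ d) a =
      ∑ e ∈ (Finset.antidiagonal d).erase (0, d), hsCoeff b ψ e.1 a • hsCoeff b ψ e.2 := by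
  have h0 : ((0 : ι →₀ ℕ), d) ∈ Finset.antidiagonal d := Finset.mem_antidiagonal.2 (zero_add d)
  ext t
  rw [commMul_apply, hsCoeff_mul ψ hd, LinearMap.sum_apply, ← Finset.add_sum_erase _ _ h0]
  simp only [LinearMap.smul_apply, smul_eq_mul, hsCoeff_apply, hψ]
  ring

/-- **The Hasse–Schmidt lemma**: if `ψ : B → B[X] ⧸ (X)^b` is a `K`-algebra map with constant term the identity,
its coefficient `D_d`, `|d| < b`, is a differential operator of `B/K` of order `≤ |d|` — induction on `|d|` via
`[D_d, a] = Σ_{e₁ ≠ 0} D_{e₁}(a) D_{e₂}` with `|e₂| < |d|`. [cite: EGAIV4, Prop. 16.8.8 (b) (recursive commutator criterion)] -/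
theorem isDiffOpLE_hsCoeff (ψ : B →ₐ[K] MvPolynomial ι B ⧸ idealOfVars ι B ^ b)
    (hψ : ∀ g, truncCoeff B ι b 0 (ψ g) = g) :
    ∀ (n : ℕ) (d : ι →₀ ℕ), d.degree = n → n < b → IsDiffOpLE K n (hsCoeff b ψ d) := by
  classical
  intro n
  induction n using Nat.strong_induction_on with
  | _ n ih =>
    intro d hdn hnb
    rcases Nat.eq_zero_or_pos n with rfl | hnpos
    · -- `d = 0`, `D_0 = id`
      obtain rfl : d = 0 := (Finsupp.degree_eq_zero_iff d).mp hdn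
      have hid : hsCoeff b ψ 0 = LinearMap.id := LinearMap.ext fun g => by
        rw [hsCoeff_apply, hψ, LinearMap.id_apply]
      rw [hid]
      exact isDiffOpLE_id
    · obtain ⟨m, rfl⟩ : ∃ m, n = m + 1 := ⟨n - 1, (Nat.succ_pred_eq_of_pos hnpos).symm⟩
      rw [isDiffOpLE_succ_iff]
      intro a
      rw [commMul_hsCoeff ψ hψ (hdn ▸ hnb) a]
      refine IsDiffOpLE.sum _ fun e he => IsDiffOpLE.smul _ ?_
      obtain ⟨hne, he'⟩ := Finset.mem_erase.mp he
      have hsum : e.1.degree + e.2.degree = m + 1 := by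
        rw [← map_add, Finset.mem_antidiagonal.mp he', hdn]
      have hpos : 0 < e.1.degree := by
        rw [Nat.pos_iff_ne_zero, Ne, Finsupp.degree_eq_zero_iff]
        intro h0
        apply hne
        have h2 : e.2 = d := by
          have := Finset.mem_antidiagonal.mp he'
          rwa [h0, zero_add] at this
        exact Prod.ext h0 h2
      have hlt : e.2.degree < m + 1 := by omega
      exact IsDiffOpLE.of_le (Nat.lt_succ_iff.mp hlt)
        (ih e.2.degree hlt e.2 rfl (hlt.trans (hdn ▸ hnb)))

/-- The Hasse–Schmidt lemma, membership form: `D_d(g) ∈ Diff^{≤|d|}(X)` for `g ∈ X`, `|d| < b`. [cite: EGAIV4, Prop. 16.8.8 (b) (orders of differential operators; D(I) ⊆ P^{m−n} for I ⊆ P^m)] -/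
theorem hsCoeff_mem_diffIdeal (ψ : B →ₐ[K] MvPolynomial ι B ⧸ idealOfVars ι B ^ b)
    (hψ : ∀ g, truncCoeff B ι b 0 (ψ g) = g) {d : ι →₀ ℕ} (hd : d.degree < b) {X : Ideal B} {g : B}
    (hg : g ∈ X) : hsCoeff b ψ d g ∈ diffIdeal K d.degree X :=
  apply_mem_diffIdeal K (isDiffOpLE_hsCoeff ψ hψ d.degree d rfl hd) hg

end Trunc

end TruncPoly

end Literature.AlgebraicGeometry.Resolution
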